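import Literature.Analysis.FluidPDE.KatoLocalL3Exists
import HarnessLib

/-!
# Decay of the free evolution in `L³(ℝ³)`

Analysis/FluidPDE support file (theorems only) on the discharge path of
`Literature.Analysis.FluidPDE.GIP2003_L3_stability` (Gallagher–Iftimie–Planchon 2003, Thm. 0.1):
the elementary fact that the caloric extension of an `L³` field tends to zero in `L³`,
`‖e^{σΔ}g‖₃ → 0` as `σ → ∞` (density of compactly supported continuous fields in `L³`, the
`L² → L³` smoothing bound `‖e^{σΔ}h‖₃ ≤ C σ^{-1/4}‖h‖₂` in dimension three, and the `L³`
contraction). In the proof of GIP's Thm. 2.1 this is what makes the free part of the solution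
small at large times (GIP 2003, Prop. A.2, "small solutions vanish at infinity", p. 1394: "for
small data, we know (A.2) that the solution vanishes at infinity").

## References

* I. Gallagher, D. Iftimie, F. Planchon, Ann. Inst. Fourier 53 (2003) 1387–1424, §2 p. 1394 and
  Prop. A.2. [GallagherIftimiePlanchon2003]
-/

noncomputable section

open MeasureTheory TopologicalSpace Set Function Filter Metric
open _root_.Topology
open scoped ENNReal NNReal

namespace Literature.Analysis.FluidPDE

namespace GIP2003

/-- **The free evolution of an `L³` field decays in `L³`**: for `g ∈ L³(ℝ³)`,
`‖e^{σΔ}g‖₃ → 0` as `σ → ∞` (density of `C_c` in `L³`, `‖e^{σΔ}h‖₃ ≤ C σ^{-1/4}‖h‖₂`, and the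
`L³` contraction of the heat semigroup). [folklore] -/
theorem tendsto_eLpNorm_heatExtension_three_atTop
    {g : EuclideanSpace ℝ (Fin 3) → EuclideanSpace ℝ (Fin 3)} (hg : MemLp g 3 volume) :
    Tendsto (fun σ : ℝ => eLpNorm (UnboundedOperators.heatExtension g σ) 3 volume) atTop (𝓝 0) := by
  obtain ⟨C, hC⟩ := UnboundedOperators.eLpNorm_heatExtension_le_rpow_holds (EuclideanSpace ℝ (Fin 3))
    (EuclideanSpace ℝ (Fin 3)) (p := 2) (q := 3) (by norm_num) (by norm_num)
  have hexp : ∀ r : ℝ, 0 < r →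
      r ^ (-((Module.finrank ℝ (EuclideanSpace ℝ (Fin 3)) : ℝ) / 2) *
        ((1 / (2 : ℝ≥0∞)).toReal - (1 / (3 : ℝ≥0∞)).toReal)) = r ^ (-(1 / 4 : ℝ)) := by
    intro r _
    congr 1
    rw [finrank_euclideanSpace_fin]
    norm_num [ENNReal.toReal_div]
  have h13 : (1 : ℝ≥0∞) ≤ 3 := by norm_num
  rw [ENNReal.tendsto_nhds_zero]
  intro ε hε
  have hε2 : ε / 2 ≠ 0 := (ENNReal.half_pos hε.ne').ne'
  -- a compactly supported continuous approximation
  obtain ⟨h, hhs, hgh, hhc, hh3⟩ := hg.exists_hasCompactSupport_eLpNorm_sub_le (by norm_num) hε2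
  have hh2 : MemLp h 2 volume := hhc.memLp_of_hasCompactSupport hhs
  -- the smoothing bound for `h` tends to zero
  have hbound : Tendsto (fun σ : ℝ => (C : ℝ≥0∞) * ENNReal.ofReal (σ ^ (-(1 / 4 : ℝ))) *
      eLpNorm h 2 volume) atTop (𝓝 0) := by
    have h1 : Tendsto (fun σ : ℝ => σ ^ (-(1 / 4 : ℝ))) atTop (𝓝 0) :=
      tendsto_rpow_neg_atTop (by norm_num)
    have h1' : Tendsto (fun σ : ℝ => ENNReal.ofReal (σ ^ (-(1 / 4 : ℝ)))) atTop (𝓝 0) := by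
      simpa using ENNReal.tendsto_ofReal h1
    have h2 : Tendsto (fun σ : ℝ => (C : ℝ≥0∞) * ENNReal.ofReal (σ ^ (-(1 / 4 : ℝ)))) atTop
        (𝓝 0) := by
      simpa using ENNReal.Tendsto.const_mul h1' (Or.inr ENNReal.coe_ne_top)
    simpa using ENNReal.Tendsto.mul_const h2 (Or.inr hh2.eLpNorm_ne_top)
  have hev : ∀ᶠ σ : ℝ in atTop, (C : ℝ≥0∞) * ENNReal.ofReal (σ ^ (-(1 / 4 : ℝ))) *
      eLpNorm h 2 volume ≤ ε / 2 :=
    ENNReal.tendsto_nhds_zero.1 hbound (ε / 2) (ENNReal.half_pos hε.ne')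
  filter_upwards [eventually_gt_atTop 0, hev] with σ hσ hσε
  have hsplit : UnboundedOperators.heatExtension g σ =
      UnboundedOperators.heatExtension (g - h) σ + UnboundedOperators.heatExtension h σ := by
    rw [← heatExtension_add_eq_of_memLp (hg.sub hh3) hh3 h13 hσ, sub_add_cancel]
  have hm1 : MemLp (UnboundedOperators.heatExtension (g - h) σ) 3 volume := by
    have := memLp_heatFlow_holds (hg.sub hh3) h13 hσ.le
    rwa [heatFlow_of_pos _ hσ] at this
  have hm2 : MemLp (UnboundedOperators.heatExtension h σ) 3 volume := by
    have := memLp_heatFlow_holds hh3 h13 hσ.le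
    rwa [heatFlow_of_pos _ hσ] at this
  have hcontr : eLpNorm (UnboundedOperators.heatExtension (g - h) σ) 3 volume ≤ ε / 2 := by
    have h1 := eLpNorm_heatFlow_le_holds (hg.sub hh3) h13 hσ.le
    rw [heatFlow_of_pos _ hσ] at h1
    exact h1.trans hgh
  have hsmooth : eLpNorm (UnboundedOperators.heatExtension h σ) 3 volume ≤ ε / 2 := by
    have h1 := hC h hh2 σ hσ
    rw [hexp σ hσ] at h1
    exact h1.trans hσε
  calc eLpNorm (UnboundedOperators.heatExtension g σ) 3 volume
      ≤ eLpNorm (UnboundedOperators.heatExtension (g - h) σ) 3 volume +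
          eLpNorm (UnboundedOperators.heatExtension h σ) 3 volume := by
        rw [hsplit]
        exact eLpNorm_add_le hm1.1 hm2.1 h13
    _ ≤ ε / 2 + ε / 2 := add_le_add hcontr hsmooth
    _ = ε := ENNReal.add_halves ε

end GIP2003

end Literature.Analysis.FluidPDE

end
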